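import Summits.KontsevichZagierPeriods.Zeta5Search.Certificates.RayC5LineMax
import HarnessLib

/-!
# ζ(5) search — certificates: the lattice line through the summand of the ray RayC5 — decay and summable majorant
(cell `pub-zeta5`, P1 g11; port of certifier 2's `Certificates/RecordRayLineMajorant.lean`)

HONEST FRAMING: systematic search; no irrationality claim unless certified.

OUR work (Summit side). With the decay certificate (`RayC5LineDecay*`: `stepDen·(a+1/2)⁴ ≤ stepNum·(a−1/2)⁴` for `a ≥ 25n`):
`N(k)·(k+h)⁴ ≤ Mx·(25n+1/2)⁴` beyond `|k+h| ≥ 25n+1/2`, and **`norm_Rc_int_le_majorC5`**: `|R_b(k+iY)| ≤ g(k)` with the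
telescoping majorant `g(k) = √Mx·(25n+3)(25n+4)/((|k−k₀|+1)(|k−k₀|+2))`, `Σ_k g(k) = (3/2)√Mx(25n+3)(25n+4)` (`hasSum_majorC5`).
-/

noncomputable section

open Finset Complex Filter Topology

namespace Summit.KontsevichZagierPeriods.Zeta5Search.RayC5

open Summit.KontsevichZagierPeriods.Zeta5Search.DualSeries
open Summit.KontsevichZagierPeriods.Zeta5Search.DualSeriesBounds (natB natB_zero natB_succ)
open Summit.KontsevichZagierPeriods.Zeta5Search.DualPF (Rc)
open Summit.KontsevichZagierPeriods.Zeta5Search.RecordLine (qsq Dx Nm Dx_pos Nm_pos normSq_Rc_mul Nm_step Dx_step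
  qsq_neg Nm_symm Dx_symm iter_mono iter_threshold hasSum_telescope_nat hasSum_inv_abs)

/-! ### Lattice centre, majorant, telescoping sums -/

/-- The lattice centre `k₀ = −⌊(51n+2)/2⌋`, `|k₀ + h| ≤ 1/2`. -/
def kCtrC5 (n : ℕ) : ℤ := -(((51 * n + 2 : ℕ) : ℤ) / 2)

/-- `|k₀ + h| ≤ 1/2`. -/
theorem abs_kCtrC5_add_le (n : ℕ) : |(kCtrC5 n : ℝ) + ((((51 * n : ℕ) : ℝ) + 2) / 2)| ≤ 1 / 2 := by
  unfold kCtrC5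
  set x : ℤ := ((51 * n + 2 : ℕ) : ℤ) with hx
  have hqr : 2 * (x / 2) + x % 2 = x := Int.mul_ediv_add_emod x 2
  have hr : x % 2 = 0 ∨ x % 2 = 1 := Int.emod_two_eq_zero_or_one x
  have hxR : ((51 * n : ℕ) : ℝ) + 2 = (x : ℝ) := by rw [hx]; push_cast; ring
  have hqrR : 2 * ((x / 2 : ℤ) : ℝ) + ((x % 2 : ℤ) : ℝ) = (x : ℝ) := by exact_mod_cast hqr
  rw [hxR, abs_le]
  push_cast
  rcases hr with h0 | h1
  · have : ((x % 2 : ℤ) : ℝ) = 0 := by exact_mod_cast h0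
    constructor <;> linarith
  · have : ((x % 2 : ℤ) : ℝ) = 1 := by exact_mod_cast h1
    constructor <;> linarith

/-- The majorant `g(k) = √MxC5·(20n+3)(20n+4)/((|k−k₀|+1)(|k−k₀|+2))`. -/
def majorC5 (e n : ℕ) (Y : ℝ) (k : ℤ) : ℝ :=
  Real.sqrt (MxC5 e n Y) * ((25 * n + 3) * (25 * n + 4)) / ((|((k - kCtrC5 n : ℤ) : ℝ)| + 1) * (|((k - kCtrC5 n : ℤ) : ℝ)| + 2))

/-- **`Σ_{k∈ℤ} g(k) = (3/2)·√MxC5·(20n+3)(20n+4)`.** -/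
theorem hasSum_majorC5 (e n : ℕ) (Y : ℝ) :
    HasSum (majorC5 e n Y) (3 / 2 * (Real.sqrt (MxC5 e n Y) * ((25 * n + 3) * (25 * n + 4)))) := by
  have h := ((Equiv.subRight (kCtrC5 n)).hasSum_iff.2 hasSum_inv_abs).mul_left
    (Real.sqrt (MxC5 e n Y) * ((25 * n + 3) * (25 * n + 4)))
  rw [show Real.sqrt (MxC5 e n Y) * ((25 * n + 3) * (25 * n + 4)) * (3 / 2 : ℝ) =
    3 / 2 * (Real.sqrt (MxC5 e n Y) * ((25 * n + 3) * (25 * n + 4))) by ring] at h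
  refine h.congr_fun fun k => ?_
  simp only [Function.comp, Equiv.subRight_apply, majorC5]
  push_cast
  ring

/-! ### Decay away from the centre and the majorant bound -/

section Lattice

variable {e n : ℕ} (he : e ≤ 1) (hn : 1 ≤ n) {Y : ℝ} (hY : 0 < Y)
  (hcert : ∀ a : ℝ, 1 / 2 ≤ a → stepDenC5 e n Y a ≤ stepNumC5 e n Y a)
  (hdec : ∀ a : ℝ, 25 * n ≤ a → stepDenC5 e n Y a * (a + 1 / 2) ^ 4 ≤ stepNumC5 e n Y a * (a - 1 / 2) ^ 4)
include he hn hY hcert hdec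


omit hcert in
/-- The decaying step: `N(x)·(x+h)⁴ ≤ N(x+1)·(x+h+1)⁴` for `−(x+h) ≥ 20n + 1/2`. -/
theorem NSqC5_decay_step (x : ℝ) (hx : 25 * (n : ℝ) + 1 / 2 ≤ -(x + ((((51 * n : ℕ) : ℝ) + 2) / 2))) :
    NSqC5 e n Y x * (x + ((((51 * n : ℕ) : ℝ) + 2) / 2)) ^ 4 ≤
      NSqC5 e n Y (x + 1) * (x + 1 + ((((51 * n : ℕ) : ℝ) + 2) / 2)) ^ 4 := by
  set h : ℝ := ((((51 * n : ℕ) : ℝ) + 2) / 2) with hh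
  set a : ℝ := -x - h - 1 / 2 with ha
  have ha20 : 25 * (n : ℝ) ≤ a := by linarith
  have hd := hdec a ha20
  -- `a + 1/2 = -(x+h)`, `a - 1/2 = -(x+h+1)`
  have e1 : (a + 1 / 2) ^ 4 = (x + h) ^ 4 := by rw [show a + 1 / 2 = -(x + h) by rw [ha]; ring]; ring
  have e2 : (a - 1 / 2) ^ 4 = (x + 1 + h) ^ 4 := by rw [show a - 1 / 2 = -(x + 1 + h) by rw [ha]; ring]; ring
  rw [e1, e2] at hd
  -- from `Den·(x+h)^4 ≤ Num·(x+h+1)^4` and `N(x)·Den-side = ...`: use the normalised identities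
  have hreg := hreg_c5E he hn
  have h0 := normSq_Rc_mul (51 * n) (BC5E e n) hreg (x := x) hY.ne'
  have h1 := normSq_Rc_mul (51 * n) (BC5E e n) hreg (x := x + 1) hY.ne'
  have hD0 := Dx_pos (51 * n) (BC5E e n) hY x
  have hD1 := Dx_pos (51 * n) (BC5E e n) hY (x + 1)
  have hN := Nm_step (51 * n) Y x
  have hDs := Dx_step (51 * n) (BC5E e n) hreg Y x
  have ha' : a = -x - ((51 * n : ℕ) + 2 : ℝ) / 2 - 1 / 2 := by rw [ha, hh]
  rw [ha', stepNumC5_eq, stepDenC5_eq e n Y x he hn] at hd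
  have hc : 0 < ∏ j ∈ range 7, qsq Y (x + 1 + (BC5E e n j : ℝ)) := prod_pos fun _ _ => by unfold qsq; positivity
  have hq1 : 0 < qsq Y (x + (((51 * n : ℕ) : ℝ) + 2) / 2) * qsq Y (x + 1) := by unfold qsq; positivity
  have hNm := Nm_pos (51 * n) hY x
  -- key: Nm(x) D(x+1) (x+h)^4 ≤ Nm(x+1) D(x) (x+h+1)^4
  have key : Nm (51 * n) Y x * Dx (51 * n) (BC5E e n) Y (x + 1) * (x + h) ^ 4 ≤
      Nm (51 * n) Y (x + 1) * Dx (51 * n) (BC5E e n) Y x * (x + 1 + h) ^ 4 := by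
    have := mul_le_mul_of_nonneg_left hd (mul_pos hNm hD0).le
    have lhs : Nm (51 * n) Y x * Dx (51 * n) (BC5E e n) Y x *
        (qsq Y (x + (((51 * n : ℕ) : ℝ) + 2) / 2) * qsq Y (x + 1) *
          (∏ j ∈ range 7, qsq Y (x + 1 + ((51 * n + 1 - BC5E e n j : ℕ) : ℝ))) * (x + h) ^ 4) =
        (Nm (51 * n) Y x * Dx (51 * n) (BC5E e n) Y (x + 1) * (x + h) ^ 4) *
          ((qsq Y (x + (((51 * n : ℕ) : ℝ) + 2) / 2) * qsq Y (x + 1)) *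
            ∏ j ∈ range 7, qsq Y (x + 1 + (BC5E e n j : ℝ))) := by
      calc Nm (51 * n) Y x * Dx (51 * n) (BC5E e n) Y x *
            (qsq Y (x + (((51 * n : ℕ) : ℝ) + 2) / 2) * qsq Y (x + 1) *
              (∏ j ∈ range 7, qsq Y (x + 1 + ((51 * n + 1 - BC5E e n j : ℕ) : ℝ))) * (x + h) ^ 4)
          = Nm (51 * n) Y x * (qsq Y (x + (((51 * n : ℕ) : ℝ) + 2) / 2) * qsq Y (x + 1)) * (x + h) ^ 4 *
              (Dx (51 * n) (BC5E e n) Y x *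
                ∏ j ∈ range 7, qsq Y (x + 1 + ((51 * n + 1 - BC5E e n j : ℕ) : ℝ))) := by ring
        _ = Nm (51 * n) Y x * (qsq Y (x + (((51 * n : ℕ) : ℝ) + 2) / 2) * qsq Y (x + 1)) * (x + h) ^ 4 *
              (Dx (51 * n) (BC5E e n) Y (x + 1) * ∏ j ∈ range 7, qsq Y (x + 1 + (BC5E e n j : ℝ))) := by
            rw [hDs]
        _ = _ := by ring
    have rhs : Nm (51 * n) Y x * Dx (51 * n) (BC5E e n) Y x *
        (qsq Y (x + 1 + (((51 * n : ℕ) : ℝ) + 2) / 2) * qsq Y (x + 1 + ((51 * n + 1 : ℕ) : ℝ)) *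
          (∏ j ∈ range 7, qsq Y (x + 1 + (BC5E e n j : ℝ))) * (x + 1 + h) ^ 4) =
        (Nm (51 * n) Y (x + 1) * Dx (51 * n) (BC5E e n) Y x * (x + 1 + h) ^ 4) *
          ((qsq Y (x + (((51 * n : ℕ) : ℝ) + 2) / 2) * qsq Y (x + 1)) *
            ∏ j ∈ range 7, qsq Y (x + 1 + (BC5E e n j : ℝ))) := by
      push_cast at hN ⊢
      calc Nm (51 * n) Y x * Dx (51 * n) (BC5E e n) Y x *
            (qsq Y (x + 1 + ((51 : ℝ) * n + 2) / 2) * qsq Y (x + 1 + ((51 : ℝ) * n + 1)) *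
              (∏ j ∈ range 7, qsq Y (x + 1 + (BC5E e n j : ℝ))) * (x + 1 + h) ^ 4)
          = (Nm (51 * n) Y x * (qsq Y (x + 1 + ((51 : ℝ) * n + 2) / 2) * qsq Y (x + 1 + ((51 : ℝ) * n + 1)))) *
              Dx (51 * n) (BC5E e n) Y x * (∏ j ∈ range 7, qsq Y (x + 1 + (BC5E e n j : ℝ))) *
              (x + 1 + h) ^ 4 := by ring
        _ = (Nm (51 * n) Y (x + 1) * (qsq Y (x + ((51 : ℝ) * n + 2) / 2) * qsq Y (x + 1))) *
              Dx (51 * n) (BC5E e n) Y x * (∏ j ∈ range 7, qsq Y (x + 1 + (BC5E e n j : ℝ))) *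
              (x + 1 + h) ^ 4 := by rw [hN]
        _ = _ := by ring
    rw [lhs, rhs] at this
    exact le_of_mul_le_mul_right this (mul_pos hq1 hc)
  have eq0 : NSqC5 e n Y x = Nm (51 * n) Y x / Dx (51 * n) (BC5E e n) Y x := by
    unfold NSqC5; rw [eq_div_iff hD0.ne']; exact h0
  have eq1 : NSqC5 e n Y (x + 1) = Nm (51 * n) Y (x + 1) / Dx (51 * n) (BC5E e n) Y (x + 1) := by
    unfold NSqC5; rw [eq_div_iff hD1.ne']; exact h1
  rw [eq0, eq1, div_mul_eq_mul_div, div_mul_eq_mul_div, div_le_div_iff₀ hD0 hD1]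
  calc Nm (51 * n) Y x * (x + h) ^ 4 * Dx (51 * n) (BC5E e n) Y (x + 1)
      = Nm (51 * n) Y x * Dx (51 * n) (BC5E e n) Y (x + 1) * (x + h) ^ 4 := by ring
    _ ≤ Nm (51 * n) Y (x + 1) * Dx (51 * n) (BC5E e n) Y x * (x + 1 + h) ^ 4 := key
    _ = Nm (51 * n) Y (x + 1) * (x + 1 + h) ^ 4 * Dx (51 * n) (BC5E e n) Y x := by ring

/-- **Decay to the left**: for `k ∈ ℤ` with `k + h ≤ −(20n + 1/2)`: `N(k)·(k+h)⁴ ≤ MxC5·(20n+1/2)⁴`. -/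
theorem NSqC5_int_decay_left (k : ℤ) (hk : (k : ℝ) + ((((51 * n : ℕ) : ℝ) + 2) / 2) ≤ -(25 * n + 1 / 2)) :
    NSqC5 e n Y k * ((k : ℝ) + ((((51 * n : ℕ) : ℝ) + 2) / 2)) ^ 4 ≤ MxC5 e n Y * (25 * n + 1 / 2) ^ 4 := by
  set h : ℝ := ((((51 * n : ℕ) : ℝ) + 2) / 2) with hh
  set v : ℝ := (k : ℝ) + h with hv
  set c : ℝ := 25 * n + 1 / 2 with hc
  set m : ℕ := ⌊-v - c⌋₊ + 1 with hm
  have hvc : 0 ≤ -v - c := by linarith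
  have hfl : ((⌊-v - c⌋₊ : ℕ) : ℝ) ≤ -v - c := Nat.floor_le hvc
  have hfl' : -v - c < ((⌊-v - c⌋₊ : ℕ) : ℝ) + 1 := Nat.lt_floor_add_one _
  have hmR : (m : ℝ) = ((⌊-v - c⌋₊ : ℕ) : ℝ) + 1 := by rw [hm]; push_cast; ring
  have hiter : NSqC5 e n Y (k : ℝ) * ((k : ℝ) + h) ^ 4 ≤ NSqC5 e n Y ((k : ℝ) + m) * ((k : ℝ) + m + h) ^ 4 :=
    iter_threshold (F := fun x => NSqC5 e n Y x * (x + h) ^ 4) (h := h) (c := c)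
      (fun x hx => NSqC5_decay_step he hn hY hdec x hx) m k (by rw [hmR]; linarith)
  refine hiter.trans ?_
  -- at the landing point: `|v + m| ≤ c` and `N ≤ MxC5`
  have hland1 : -(v + m) < c := by rw [hmR]; linarith
  have hland2 : c - 1 ≤ -(v + m) := by rw [hmR]; linarith
  have hn1 : (1 : ℝ) ≤ n := by exact_mod_cast hn
  have hc1 : 1 ≤ c := by rw [hc]; linarith
  have habs : |(k : ℝ) + m + h| ≤ c := by
    rw [abs_le]; constructor <;> linarith
  have hpow : ((k : ℝ) + m + h) ^ 4 ≤ c ^ 4 := by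
    have := pow_le_pow_left₀ (abs_nonneg _) habs 4
    rwa [pow_abs, abs_of_nonneg (by positivity : (0 : ℝ) ≤ ((k : ℝ) + m + h) ^ 4)] at this
  have hN : NSqC5 e n Y ((k : ℝ) + m) ≤ MxC5 e n Y := by
    have := NSqC5_int_le_Mx he hn hY hcert (k + m)
    push_cast at this
    exact this
  calc NSqC5 e n Y ((k : ℝ) + m) * ((k : ℝ) + m + h) ^ 4 ≤ MxC5 e n Y * c ^ 4 :=
        mul_le_mul hN hpow (by positivity) (MxC5_nonneg _ _ _)
    _ = MxC5 e n Y * (25 * n + 1 / 2) ^ 4 := by rw [hc]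

/-- **Decay on both sides**: for `k ∈ ℤ` with `|k + h| ≥ 20n + 1/2`: `N(k)·(k+h)⁴ ≤ MxC5·(20n+1/2)⁴`. -/
theorem NSqC5_int_decay (k : ℤ) (hk : 25 * (n : ℝ) + 1 / 2 ≤ |(k : ℝ) + ((((51 * n : ℕ) : ℝ) + 2) / 2)|) :
    NSqC5 e n Y k * ((k : ℝ) + ((((51 * n : ℕ) : ℝ) + 2) / 2)) ^ 4 ≤ MxC5 e n Y * (25 * n + 1 / 2) ^ 4 := by
  set h : ℝ := ((((51 * n : ℕ) : ℝ) + 2) / 2) with hh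
  by_cases hneg : (k : ℝ) + h ≤ 0
  · rw [abs_of_nonpos hneg] at hk
    exact NSqC5_int_decay_left he hn hY hcert hdec k (by linarith)
  · push Not at hneg
    rw [abs_of_pos hneg] at hk
    -- reflect to `k' = −(51n+2) − k`
    set k' : ℤ := -((51 * n + 2 : ℕ) : ℤ) - k with hk'
    have hsymm := NSqC5_symm_int he hn hY k
    have e2 : (k' : ℝ) + h = -((k : ℝ) + h) := by rw [hk', hh]; push_cast; ring
    have hleft := NSqC5_int_decay_left he hn hY hcert hdec k' (by rw [e2]; linarith)
    rw [hsymm, e2] at hleft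
    calc NSqC5 e n Y k * ((k : ℝ) + h) ^ 4 = NSqC5 e n Y k * (-((k : ℝ) + h)) ^ 4 := by ring
      _ ≤ MxC5 e n Y * (25 * n + 1 / 2) ^ 4 := hleft

/-! ### The telescoping majorant -/

/-- **`|R_b(k+iY)| ≤ g(k)` for every `k ∈ ℤ`.** -/
theorem norm_Rc_int_le_majorC5 (k : ℤ) :
    ‖Rc (natB (51 * n) (BC5E e n)) ((k : ℂ) + Y * I)‖ ≤ majorC5 e n Y k := by
  set h : ℝ := ((((51 * n : ℕ) : ℝ) + 2) / 2) with hh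
  set J : ℝ := |((k - kCtrC5 n : ℤ) : ℝ)| with hJ
  have hJ0 : 0 ≤ J := abs_nonneg _
  have hMx := MxC5_nonneg e n Y
  have hsq : ‖Rc (natB (51 * n) (BC5E e n)) ((k : ℂ) + Y * I)‖ ^ 2 = NSqC5 e n Y k := by
    unfold NSqC5; push_cast; rfl
  have hnorm0 : 0 ≤ ‖Rc (natB (51 * n) (BC5E e n)) ((k : ℂ) + Y * I)‖ := norm_nonneg _
  -- global bound `‖R‖ ≤ √MxC5`
  have hglob : ‖Rc (natB (51 * n) (BC5E e n)) ((k : ℂ) + Y * I)‖ ≤ Real.sqrt (MxC5 e n Y) := by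
    rw [← Real.sqrt_sq hnorm0, hsq]
    exact Real.sqrt_le_sqrt (NSqC5_int_le_Mx he hn hY hcert k)
  unfold majorC5
  rw [← hJ]
  have hden : 0 < (J + 1) * (J + 2) := by positivity
  rw [le_div_iff₀ hden]
  by_cases hJc : J ≤ 25 * n + 2
  · -- near the centre: `(J+1)(J+2) ≤ (20n+3)(20n+4)`
    calc ‖Rc (natB (51 * n) (BC5E e n)) ((k : ℂ) + Y * I)‖ * ((J + 1) * (J + 2))
        ≤ Real.sqrt (MxC5 e n Y) * ((J + 1) * (J + 2)) := by gcongr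
      _ ≤ Real.sqrt (MxC5 e n Y) * ((25 * n + 3) * (25 * n + 4)) := by
          apply mul_le_mul_of_nonneg_left _ (Real.sqrt_nonneg _)
          nlinarith
  · push Not at hJc
    -- far: use the decay `N(k)·v⁴ ≤ MxC5·c⁴` with `|v| ≥ J − 1/2 ≥ 20n + 1/2`
    have hctr := abs_kCtrC5_add_le n
    have hv : J - 1 / 2 ≤ |(k : ℝ) + h| := by
      have e1 : (k : ℝ) + h = (((k - kCtrC5 n : ℤ) : ℝ)) + ((kCtrC5 n : ℝ) + h) := by push_cast; ring
      rw [e1]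
      have := abs_sub_abs_le_abs_sub (((k - kCtrC5 n : ℤ) : ℝ)) (-((kCtrC5 n : ℝ) + h))
      rw [sub_neg_eq_add, abs_neg] at this
      have hctr' : |(kCtrC5 n : ℝ) + h| ≤ 1 / 2 := by rw [hh]; exact hctr
      linarith [hJ]
    have hvc : 25 * (n : ℝ) + 1 / 2 ≤ |(k : ℝ) + h| := by linarith
    have hdk := NSqC5_int_decay he hn hY hcert hdec k hvc
    have hvpos : 0 < |(k : ℝ) + h| := by
      have : (1 : ℝ) ≤ n := by exact_mod_cast hn
      linarith
    -- integrality: `J ≥ 20n + 3`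
    have hJ3 : (25 : ℝ) * n + 3 ≤ J := by
      have hJnat : J = (((k - kCtrC5 n).natAbs : ℕ) : ℝ) := by
        rw [hJ, Nat.cast_natAbs, Int.cast_abs]
      rw [hJnat] at hJc ⊢
      have : 25 * n + 2 < (k - kCtrC5 n).natAbs := by exact_mod_cast hJc
      exact_mod_cast (show 25 * n + 3 ≤ (k - kCtrC5 n).natAbs by omega)
    -- `‖R‖ · v² ≤ √MxC5 · c²`
    have hRv : ‖Rc (natB (51 * n) (BC5E e n)) ((k : ℂ) + Y * I)‖ * ((k : ℝ) + h) ^ 2 ≤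
        Real.sqrt (MxC5 e n Y) * (25 * n + 1 / 2) ^ 2 := by
      have hsq2 : (‖Rc (natB (51 * n) (BC5E e n)) ((k : ℂ) + Y * I)‖ * ((k : ℝ) + h) ^ 2) ^ 2 ≤
          (Real.sqrt (MxC5 e n Y) * (25 * n + 1 / 2) ^ 2) ^ 2 := by
        rw [mul_pow, mul_pow, hsq, Real.sq_sqrt hMx, ← pow_mul, ← pow_mul]
        exact hdk
      exact (pow_le_pow_iff_left₀ (by positivity) (by positivity) two_ne_zero).1 hsq2
    have hv2 : (J - 1 / 2) ^ 2 ≤ ((k : ℝ) + h) ^ 2 := by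
      have hJh : 0 ≤ J - 1 / 2 := by linarith
      have := pow_le_pow_left₀ hJh hv 2
      rwa [sq_abs] at this
    have hvsq : 0 < ((k : ℝ) + h) ^ 2 := by rw [← sq_abs]; exact pow_pos hvpos 2
    -- the domination inequality `c²(J+1)(J+2) ≤ (20n+3)(20n+4)(J−1/2)²`
    have hpoly : (25 * (n : ℝ) + 1 / 2) ^ 2 * ((J + 1) * (J + 2)) ≤ ((25 * n + 3) * (25 * n + 4)) * (J - 1 / 2) ^ 2 := by
      have hn1 : (1 : ℝ) ≤ n := by exact_mod_cast hn
      obtain ⟨s', t', hs', ht', eJ, en⟩ : ∃ s' t' : ℝ, 0 ≤ s' ∧ 0 ≤ t' ∧ J = 25 * n + 3 + s' ∧ (n : ℝ) = 1 + t' :=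
        ⟨J - 25 * n - 3, n - 1, by linarith, by linarith, by ring, by ring⟩
      have key : ((25 * (n : ℝ) + 3) * (25 * n + 4)) * (J - 1 / 2) ^ 2 - (25 * (n : ℝ) + 1 / 2) ^ 2 * ((J + 1) * (J + 2)) =
          96715 / 2 + 251575 / 2 * t' + 108750 * t' ^ 2 + 31250 * t' ^ 3 + 25181 / 4 * s' + 22475 / 2 * s' * t' + 5000 * s' * t' ^ 2 + 647 / 4 * s' ^ 2 + 150 * s' ^ 2 * t' := by
        rw [eJ, en]; ring
      have : 0 ≤ 96715 / 2 + 251575 / 2 * t' + 108750 * t' ^ 2 + 31250 * t' ^ 3 + 25181 / 4 * s' + 22475 / 2 * s' * t' + 5000 * s' * t' ^ 2 + 647 / 4 * s' ^ 2 + 150 * s' ^ 2 * t' := by positivity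
      linarith
    refine le_of_mul_le_mul_right ?_ hvsq
    calc ‖Rc (natB (51 * n) (BC5E e n)) ((k : ℂ) + Y * I)‖ * ((J + 1) * (J + 2)) * ((k : ℝ) + h) ^ 2
        = (‖Rc (natB (51 * n) (BC5E e n)) ((k : ℂ) + Y * I)‖ * ((k : ℝ) + h) ^ 2) * ((J + 1) * (J + 2)) := by ring
      _ ≤ (Real.sqrt (MxC5 e n Y) * (25 * n + 1 / 2) ^ 2) * ((J + 1) * (J + 2)) := by gcongr
      _ = Real.sqrt (MxC5 e n Y) * ((25 * n + 1 / 2) ^ 2 * ((J + 1) * (J + 2))) := by ring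
      _ ≤ Real.sqrt (MxC5 e n Y) * (((25 * n + 3) * (25 * n + 4)) * (J - 1 / 2) ^ 2) :=
          mul_le_mul_of_nonneg_left hpoly (Real.sqrt_nonneg _)
      _ ≤ Real.sqrt (MxC5 e n Y) * (((25 * n + 3) * (25 * n + 4)) * ((k : ℝ) + h) ^ 2) := by gcongr
      _ = Real.sqrt (MxC5 e n Y) * ((25 * n + 3) * (25 * n + 4)) * ((k : ℝ) + h) ^ 2 := by ring

end Lattice

end Summit.KontsevichZagierPeriods.Zeta5Search.RayC5
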